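import Mathlib
import HarnessLib
import Summits.Langlands.Langlands.Statement
import Summits.Langlands.Langlands.Theses.EisensteinDegreeShift
import Summits.Langlands.Langlands.Theorems.IrreducibilityBySelfDualityReciprocityUpToIrreducibilityCorrespondsConj
import Literature.NumberTheory.Automorphic.ReciprocityGLnDescentProofs
import Literature.NumberTheory.Automorphic.TunnellOctahedralGlobal
import Literature.NumberTheory.GaloisRepresentations.FrobeniusDensityTheorem
import Literature.NumberTheory.GaloisRepresentations.FrobeniusPlaces
import Literature.NumberTheory.GaloisRepresentations.ToLocalRestrictField
import Literature.NumberTheory.PAdicHodge.DeRhamBaseChange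
import Literature.NumberTheory.PAdicHodge.DeRhamDescent

/-!
# `EisensteinDegreeShift.SolubleDescentGLn` (item stmt-Langlands-18371): the item is a consequence of
# the summit — `Langlands → SolubleDescentGLn`, modulo de Rham DESCENT along a finite extension

Support file (`--supports stmt-Langlands-18371`) for the route `EisensteinDegreeShift`, item S3
`SolubleDescentGLn` ("soluble descent given the Galois representation": `K'/K` soluble Galois, `K`, `K'`
CM, `ρ : Γ_K → GL_n(ℚ̄_p)` irreducible with `ρ|_{Γ_{K'}}` irreducible and Satake–Frobenius compatible a.e.
with an L-algebraic cuspidal `π'` of `GL_n(𝔸_{K'})` ⟹ `ρ` is Satake–Frobenius compatible a.e. with an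
L-algebraic cuspidal `π` of `GL_n(𝔸_K)`).

What is proved here (kernel-checked position of the item, not a proof of it):

* `solubleDescentGLn_of_langlands` — **`DeRhamDescent → Langlands → SolubleDescentGLn`**: the item is
  INSIDE the audited summit, granted the converse half of Brinon–Conrad Prop. 6.3.8 (de Rham-ness of an
  `ℓ`-adic representation is insensitive to a finite extension of the `ℓ`-adic base field; the tree holds
  the ascent half as the named fact `Literature.NumberTheory.PAdicHodge.DeRhamBaseChange`, the descent
  half is stated here as `DeRhamDescent`, same binders, hypothesis and conclusion exchanged).  Route of
  the proof: direction (A) of the summit over `K'` attaches to `π'` an irreducible geometric `ρ'`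
  corresponding to it; two avatars of one `π'`, one irreducible, are conjugate (Chebotarev +
  Brauer–Nesbitt, the tree's `ReciprocityUpToIrreducibility.isConjugate_of_satakeFrobCompatibleAt`), so
  `ρ|_{Γ_{K'}}` is geometric; unramifiedness a.e. descends to `K` at the places unramified in `K'/K`
  (`FramedGaloisRep.isUnramifiedAt_of_restrictField`) and de Rham-ness at `v ∣ p` descends from any
  `w ∣ v` (`isDeRhamFramed_toLocal_of_restrictField`, the plumbing of `ToLocalRestrictField` run
  backwards); direction (B) over `K` then gives `π`.  Solubility, the CM hypotheses and the
  irreducibility of `ρ|_{Γ_{K'}}` are idle in this containment (they scope the printed METHOD —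
  Arthur–Clozel cyclic descent + twist selection through `r_ι(π_F)` — not the truth of the item).
  Consequence for refuters: `¬ SolubleDescentGLn → ¬ Literature.NumberTheory.PAdicHodge.DeRhamDescent ∨ ¬ Langlands`
  (`not_langlands_of_not_solubleDescentGLn`): the item cannot be refuted short of refuting the summit or
  Brinon–Conrad 6.3.8.
* `isDeRhamFramed_toLocal_of_restrictField` — the global form of `DeRhamDescent` for the pinned data of
  the places `w ∣ v ∣ ℓ` of a finite extension `E/F` of number fields.
* `pos_of_isIrreducible_framed` — an irreducible framed representation has positive rank (the summit
  quantifies `0 < n`, the item does not; `n = 0` is vacuous).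

References: O. Brinon, B. Conrad, *CMI Summer School notes on p-adic Hodge theory* (2009), Prop. 6.3.8
("`V` is de Rham as a `G_K`-representation if and only if `V` is de Rham as a `G_{K'}`-representation");
K. Buzzard, T. Gee, *The conjectural connections between automorphic representations and Galois
representations* (2014), Conj. 3.2.1–3.2.2; P. Deligne, J.-P. Serre, ASENS 7 (1974), Lemme 3.2;
J.-P. Serre, *Abelian ℓ-adic representations* (1968), Ch. I §2.1.
-/

noncomputable section

-- `Summit.Langlands.Langlands.…` (summit = sub-problem name, D-0017 layout) trips `dupNamespace`.
set_option linter.dupNamespace false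

open scoped NumberField MatrixGroups
open Filter IsDedekindDomain Field NumberField ValuativeRel
open Literature.NumberTheory.Automorphic Literature.NumberTheory.GaloisRepresentations
  Literature.NumberTheory.PAdicHodge

namespace Summit.Langlands.Langlands.Theorems

/-! ## The named fact: de Rham-ness descends along a finite extension of the `ℓ`-adic base field -/

open Summit.Langlands Summit.Langlands.Langlands.Theses.EisensteinDegreeShift

section Pinned

variable {F E : Type} [Field F] [NumberField F] [Field E] [NumberField E] [Algebra F E]
  {ℓ : ℕ} [Fact ℓ.Prime] {n : ℕ}

/-- **De Rham-ness of the pinned data descends along `E/F`, place by place** — from `DeRhamDescent`: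
if `w ∣ v ∣ ℓ` and `(ρ|_{Γ_E})|_{Γ_{E_w}}` is de Rham for `fontainePstAdicCompletion w ℓ hw`, then
`ρ|_{Γ_{F_v}}` is de Rham for `fontainePstAdicCompletion v ℓ hv`: by the tree's main lemma
`exists_toLocal_restrictField_eq_conj`, `(ρ|_{Γ_E})|_{Γ_{E_w}}` is a change of frame of the restriction
of `ρ|_{Γ_{F_v}}` along the continuous `F_v → E_w`, de Rham-ness does not see the frame
(`PstWeilDeligneData.isDeRhamFramed_conj_iff`), and the local fact descends it to `F_v`.
[cite: BrinonConrad2009, Prop. 6.3.8] [cite: SerreAbelianLadic1968, Ch. I §2.1] -/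
theorem isDeRhamFramed_toLocal_of_restrictField (h : Literature.NumberTheory.PAdicHodge.DeRhamDescent)
    (ρ : FramedGaloisRep F (PadicAlgCl ℓ) n) (v : HeightOneSpectrum (𝓞 F))
    (w : HeightOneSpectrum (𝓞 E)) [w.asIdeal.LiesOver v.asIdeal] (hv : ((ℓ : ℕ) : 𝓞 F) ∈ v.asIdeal)
    (hw : ((ℓ : ℕ) : 𝓞 E) ∈ w.asIdeal)
    (hρ : (fontainePstAdicCompletion w ℓ hw).IsDeRhamFramed ((ρ.restrictField E).toLocal w)) :
    (fontainePstAdicCompletion v ℓ hv).IsDeRhamFramed (ρ.toLocal v) := by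
  letI := (adicCompletionOfLiesOver F E v w).toAlgebra
  obtain ⟨τ, hτ⟩ := exists_toLocal_restrictField_eq_conj ρ v w
  rw [hτ, PstWeilDeligneData.isDeRhamFramed_conj_iff] at hρ
  haveI := LocalField.charZero_adicCompletion v
  haveI := LocalField.charZero_adicCompletion w
  exact h (v.adicCompletion F) (w.adicCompletion E) (continuous_adicCompletionOfLiesOver F E v w) ℓ
    (LocalField.valuation_adicCompletion_natCast_lt_one v ℓ hv)
    (LocalField.valuation_adicCompletion_natCast_lt_one w ℓ hw) n (ρ.toLocal v) hρ

end Pinned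

/-! ## Rank positivity -/

/-- **An irreducible framed representation has positive rank**: for `n = 0` the representation space
`Fin 0 → A` is a subsingleton, so its lattice of subrepresentations is too, whereas Mathlib's
`Representation.IsIrreducible` (`IsSimpleOrder`) is nontrivial. [folklore] -/
theorem pos_of_isIrreducible_framed {G : Type*} [Group G] [TopologicalSpace G] {A : Type*} [Field A]
    [TopologicalSpace A] {n : ℕ} {ρ : FramedRep G A n} (h : ρ.IsIrreducible) : 0 < n := by
  rcases Nat.eq_zero_or_pos n with rfl | hn
  · exfalso
    haveI : Subsingleton (Subrepresentation ρ.toRepresentation) :=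
      Subrepresentation.toSubmodule_injective.subsingleton
    exact not_nontrivial _ h.toNontrivial
  · exact hn

/-! ## The containment `Langlands → SolubleDescentGLn` -/

/-- **The item is inside the summit, modulo de Rham descent**: `DeRhamDescent → Langlands →
SolubleDescentGLn`.  Given the hypotheses of the item at `(K, K', n, p, ι, ρ, π')`: `0 < n`
(`pos_of_isIrreducible_framed`); the summit over `K'` supplies reciprocity data `𝓡'` and, by direction
(A) for the L-algebraic cuspidal `π'`, an irreducible `𝓡'`-geometric `ρ'` corresponding to `π'`; `ρ'`
and `ρ|_{Γ_{K'}}` are two avatars of `π'` with `ρ'` irreducible, hence conjugate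
(`ReciprocityUpToIrreducibility.isConjugate_of_satakeFrobCompatibleAt`), so `ρ|_{Γ_{K'}}` is
`𝓡'`-geometric (`isGeometricFramed_of_isConjugate`); therefore `ρ` is unramified at almost every place
of `K` (descent at the places unramified in `K'/K`, `FramedGaloisRep.isUnramifiedAt_of_restrictField`,
`finite_setOf_not_isUnramifiedIn`) and de Rham at every `v ∣ p` for the pinned datum (pick `w ∣ v`,
`exists_above`; `isDeRhamFramed_toLocal_of_restrictField`), i.e. `𝓡`-geometric for the reciprocity
data `𝓡` of `K`; direction (B) over `K` gives an L-algebraic cuspidal `π` corresponding to `ρ`, in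
particular Satake–Frobenius compatible with it almost everywhere.  Solubility of `Gal(K'/K)`, the CM
hypotheses and the irreducibility of `ρ|_{Γ_{K'}}` are not used.
[cite: BuzzardGeeLMS2014, Conj. 3.2.1 and Conj. 3.2.2] [cite: BrinonConrad2009, Prop. 6.3.8] -/
theorem solubleDescentGLn_of_langlands (hdR : Literature.NumberTheory.PAdicHodge.DeRhamDescent) (hL : _root_.Langlands) :
    SolubleDescentGLn := by
  intro K _ _ K' _ _ _ hgal _hsol _hK _hK' n p _ hcpt hcpt' ι ρ hirr _hirr' hπ'
  obtain ⟨π', hπ'L, hπ'⟩ := hπ'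
  haveI : IsGalois K K' := hgal
  have hn : 0 < n := pos_of_isIrreducible_framed hirr
  -- the summit over `K'`: direction (A) for `π'`
  obtain ⟨⟨𝓡'⟩, h'⟩ := hL K'
  obtain ⟨ρ', hirr₁, hgeo₁, hcorr₁, -⟩ := (h' 𝓡' n hn hcpt').1 π' hπ'L p ι
  -- two avatars of `π'`, `ρ'` irreducible ⇒ conjugate ⇒ `ρ|_{Γ_{K'}}` is geometric
  have hconj : IsConjugate ρ' (ρ.restrictField K') :=
    ReciprocityUpToIrreducibility.isConjugate_of_satakeFrobCompatibleAt π'.1 ι hirr₁ hcorr₁.1 hπ'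
  have hgeo' : IsGeometricFramed 𝓡' (ρ.restrictField K') :=
    ReciprocityUpToIrreducibility.isGeometricFramed_of_isConjugate hgeo₁ hconj
  -- the summit over `K`: direction (B) for `ρ`, which is `𝓡`-geometric
  obtain ⟨⟨𝓡⟩, h⟩ := hL K
  have hunr : ∀ᶠ v : HeightOneSpectrum (𝓞 K) in cofinite,
      Algebra.IsUnramifiedIn (𝓞 K') v.asIdeal := by
    rw [eventually_cofinite]
    exact finite_setOf_not_isUnramifiedIn K K'
  have hae : ∀ᶠ v : HeightOneSpectrum (𝓞 K) in cofinite, ρ.IsUnramifiedAt v :=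
    ((eventually_forall_under_eq (F := K) hgeo'.1).and hunr).mono fun v hv =>
      ρ.isUnramifiedAt_of_restrictField (ramificationIdxIn_eq_one_of_isUnramifiedIn hv.2) hv.1
  have hgeo : IsGeometricFramed 𝓡 ρ := by
    refine ⟨hae, fun v hv => ?_⟩
    obtain ⟨w, hw⟩ := exists_above (E := K') v
    haveI : w.asIdeal.LiesOver v.asIdeal := ⟨hw.symm⟩
    have hwp : ((p : ℕ) : 𝓞 K') ∈ w.asIdeal := (natCast_mem_asIdeal_iff_of_liesOver v w p).2 hv
    exact isDeRhamFramed_toLocal_of_restrictField hdR ρ v w hv hwp (hgeo'.2 w hwp)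
  obtain ⟨π, hπL, hcorr⟩ := (h 𝓡 n hn hcpt).2 p ι ρ hirr hgeo
  exact ⟨π, hπL, hcorr.1⟩

/-- **Position of the item for refuters**: a refutation of `SolubleDescentGLn` refutes the audited
summit or the descent half of Brinon–Conrad Prop. 6.3.8. [folklore] -/
theorem not_langlands_of_not_solubleDescentGLn (h : ¬ SolubleDescentGLn) :
    ¬ Literature.NumberTheory.PAdicHodge.DeRhamDescent ∨ ¬ _root_.Langlands := by
  by_contra hc
  push Not at hc
  exact h (solubleDescentGLn_of_langlands hc.1 hc.2)

end Summit.Langlands.Langlands.Theorems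

end
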